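import Literature.AnabelianGeometry.EtaleTheta.FrdIVocabularyWeak
import Literature.AnabelianGeometry.EtaleTheta.DivisorMonoidsProofs
import Literature.AnabelianGeometry.EtaleTheta.Discharge.Sec3Lemma35RlfWeak
import Literature.AnabelianGeometry.EtaleTheta.Discharge.Sec3Remark351
import Literature.AlgebraicGeometry.Frobenioids.PiNatRealificationCofinal

/-!
# [EtTh] §3: Lemma 3.5 (i), (ii) and Remark 3.5.1 — DISCHARGED for the WEAK [FrdI] vocabulary
# `treeMonoidVocabWeak` (perf-factorial := weakly perf-factorial with cofinal perfection)

Mochizuki, *The étale theta function …*, Publ. RIMS **45** (2009), §3, Lemma 3.5 and Remark 3.5.1, PRIMS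
PDF pp. 75–76 (printed 301–302) [cite: MochizukiEtTh2009, Lem 3.5 p.75].  The statement file
`DivisorMonoids.lean` (seat abc-iut-L2-t3) records them as the named facts `Lemma35_i V`, `Lemma35_ii V`,
`Remark351 V` over the [FrdI]-vocabulary stub `V`; `FrdIVocabularyWeak.lean` (same seat, after the cell's
findings F-L2d2-1 / F-L2d2-2) fixes the WEAK vocabulary `treeMonoidVocabWeak`: "perf-factorial" :=
`IsPerfFactorialCof` = [FrdI] Def. 2.4 (i) (a)(b)(c) + (d_ord) + (d_res) + (d_cof) (cofinality of `M^pf`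
in `M^rlf`, Mochizuki's sentence p. 75 — WITHOUT which Lemma 3.5 (i) is false, F-L2d2-2), "realification"
:= `IsRealificationViaWeak`, "`ℝ` supports" := the printed `Supports _ .R`.

THIS FILE (weak twin of `Discharge/Sec3Lemma35Holds.lean`, seat abc-iut-L6-t12, and of
`Discharge/Sec3Remark351.lean`, this seat) turns the three named facts, read with `treeMonoidVocabWeak`,
into THEOREMS: the `P^pf` portion from `DivisorMonoidsProofs.lean` / `SubmonoidPerfection.lean`
(unchanged: only "`Q` perfect" is used), the `P^rlf` portion from the weak engine
`Discharge/Sec3Lemma35RlfWeak.lean` (`Lemma35Weak.rlf_extension_via`,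
`Lemma35Weak.isGroupSaturated_rlf_extension_via`, the (d_cof) clause of `IsPerfFactorialCof` feeding their
hypothesis `hcof`).  Also: printed perf-factorial ⇒ `IsPerfFactorialCof`
(`isPerfFactorialCof_of_isPerfFactorial`), and `∏_J ℤ≥0` — the shape of `Φ₀` at `Ÿ`, `Z_∞`, where the
printed notion fails — IS `IsPerfFactorialCof` (`PiNat.isPerfFactorialCof`), so the weak named facts are
NON-VACUOUS exactly where they are needed.  No residual hypothesis; no definitions.  Seat abc-iut-L2-d2
(cell abc-iut, F-L2d2-1 / F-L2d2-2 repair chain, node EtTh:Lem3.5).  HONEST FRAMING: classical monoid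
algebra; nothing here bears on [IUTchIII] Cor. 3.12.
-/

namespace Literature.AnabelianGeometry.EtaleTheta

open Literature.AlgebraicGeometry.Frobenioids Function

universe w

/-! ### Instances of the weak notion -/

/-- **Printed ⇒ weak vocabulary**: a perf-factorial monoid ([FrdI] Def. 2.4 (i) as printed) is weakly
perf-factorial with cofinal perfection ((d) ⇒ (d_ord), (d_res), (d_cof)).
[cite: MochizukiFrdI2008, Def. 2.4(i) p.47] -/
theorem isPerfFactorialCof_of_isPerfFactorial {M : Type w} [CommMonoid M] (h : IsPerfFactorial M) :
    IsPerfFactorialCof M :=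
  ⟨h.weak, RlfCoordWeak.rlf_cofinal_of_isPerfFactorial h⟩

/-- **`∏_J ℤ≥0` is perf-factorial in the weak vocabulary** (`IsPerfFactorialCof`), for every index type `J`
— although it is NOT perf-factorial as printed for infinite `J` (F-L2d2-1): the satisfiability witness of
`treeMonoidVocabWeak.IsPerfFactorial` at the shape of `DIV⁺(Z_∞^log)` ([EtTh] Prop. 3.2 (i)).
[cite: MochizukiEtTh2009, Prop 3.2 p.70] -/
theorem PiNat.isPerfFactorialCof (J : Type w) : IsPerfFactorialCof (Multiplicative (J → ℕ)) :=
  ⟨Literature.AlgebraicGeometry.Frobenioids.PiNat.isPerfFactorialWeak',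
    Literature.AlgebraicGeometry.Frobenioids.PiNat.rlf_cofinal'⟩

/-! ### Lemma 3.5 (i), (ii) for `treeMonoidVocabWeak` -/

/-- **[EtTh] Lemma 3.5 (i) — discharged for the weak vocabulary** (p. 75): "The inclusion `P ↪ Q` extends
uniquely to inclusions `P^pf ↪ Q`, `P^rlf ↪ Q`" for `P ⊆ Q` weakly perf-factorial WITH COFINAL
PERFECTION, `P` group-saturated in `Q`, `ℝ` supporting `Q` — the named fact `Lemma35_i` at
`treeMonoidVocabWeak` holds. [cite: MochizukiEtTh2009, Lem 3.5 p.75] -/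
theorem Lemma35_i_holds_weak : Lemma35_i treeMonoidVocabWeak.{w} := by
  intro Q _ P hP _hQ hsat hR
  refine ⟨(Lemma35_i_pf Q P hR).1, (Lemma35_i_pf Q P hR).2, ?_⟩
  intro R _ ρ hρ
  obtain ⟨h, e, he⟩ := hρ
  obtain ⟨h', hcof⟩ := hP
  exact Lemma35Weak.rlf_extension_via P h hcof hsat hR R ρ e he

/-- **[EtTh] Lemma 3.5 (ii) — discharged for the weak vocabulary** (p. 75): "Relative to the inclusions of
(i), `P^pf`, `P^rlf` are group-saturated in `Q`" — the named fact `Lemma35_ii` at `treeMonoidVocabWeak`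
holds. [cite: MochizukiEtTh2009, Lem 3.5 p.75] -/
theorem Lemma35_ii_holds_weak : Lemma35_ii treeMonoidVocabWeak.{w} := by
  intro Q _ P hP _hQ hsat hR
  refine ⟨fun ιpf hι => Lemma35_ii_pf Q P hsat hR ιpf hι, ?_⟩
  intro R _ ρ hρ ι hι
  obtain ⟨h, e, he⟩ := hρ
  obtain ⟨h', hcof⟩ := hP
  exact Lemma35Weak.isGroupSaturated_rlf_extension_via P h hcof hsat hR R ρ e he ι hι

/-! ### Remark 3.5.1 for `treeMonoidVocabWeak` -/

/-- **[EtTh] Remark 3.5.1 — discharged for the weak vocabulary** (p. 76): "a nonzero submonoid `P` of an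
`ℝ`-monoprime monoid `Q` is perf-factorial and group-saturated if and only if it is monoprime", with
"perf-factorial" read as `IsPerfFactorialCof` ("only if" uses just Def. 2.4 (i)(b) of `P`; "if": a
monoprime monoid is perf-factorial as printed, `Remark351_holds`, hence in the weak sense).
[cite: MochizukiEtTh2009, Rmk 3.5.1 p.76] -/
theorem Remark351_holds_weak : Remark351 treeMonoidVocabWeak.{w} := by
  intro Q _ P hQ hP0
  show IsPerfFactorialCof ↥P ∧ IsGroupSaturated P ↔ IsMonoprime ↥P
  constructor
  · rintro ⟨⟨hpf, -⟩, hsat⟩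
    have harch : ∀ a b : P, b ≠ 1 → a ≼ b := fun _ _ hb => precsim_of_isGroupSaturated hQ P hsat hb
    -- a non-unit of `P`
    have hne : ¬ ∀ x ∈ P, x = (1 : Q) := fun h => hP0 ((Submonoid.eq_bot_iff_forall P).mpr h)
    obtain ⟨x, hx⟩ := not_forall.mp hne
    obtain ⟨hxP, hx1⟩ := Classical.not_imp.mp hx
    have hε : (⟨x, hxP⟩ : P) ≠ 1 := fun h => hx1 (congrArg Subtype.val h)
    obtain ⟨𝔭⟩ := MonoprimeStructure.primes_nonempty harch hε
    obtain ⟨e⟩ := MonoprimeStructure.nonempty_submonoid_mulEquiv harch 𝔭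
    exact PerfectionPrimes.isMonoprime_of_mulEquiv e (hpf.isMonoprime 𝔭)
  · intro hmono
    obtain ⟨hpf, hsat⟩ := (Remark351_holds Q P hQ hP0).mpr hmono
    exact ⟨isPerfFactorialCof_of_isPerfFactorial hpf, hsat⟩

end Literature.AnabelianGeometry.EtaleTheta
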